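import Summits.ResolutionOfSingularities.ResolutionOfSingularities.Theorems.LatencyCutClasses
import HarnessLib

/-!
# LatencyCutCells — decomp-res node «LatencyCut» (lens-4 g22) refining the MaxContactCut asides 28054 / 32260;
tree file 4/5 of the node

Content VERBATIM from the decomp-res lens-4 g22 file `HOME/decomp-res-lens-4/g22/LatencyCut.lean` (sha256 6bd4fa7be8c896a2,
940 l, written directly against the tree on top of the landed g21 node «TameCut» = `Theorems/TameCutClasses`,
`TameCutKernels`,
`MaxContactCutTameCut`).  HOME = run/shared/lean/pub/decomp-res.  Critic: CRITIC-LEDGER row 137 CLEARED, landing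
order 2026-08-30T19:54:01Z.

Route-independent, cone-free (importable by the route file for the aside): §51 THE CELLS CUT ON THE LENS-4 COLUMN
at weight `n` — (O), its WILD
bed (g21's located residual), its tame–inseparable bed, (N), (W) — by the latency axis (`LatentOffLocusTowersTerminate`,
`ContactFreeOffLocusTowersTerminate`, `WildContactFreeOffLocusTowersTerminate` = THE RE-LOCATED RESIDUAL at weight
`n`, …; EXACT
`offLocus_iff_cells_g22`, `wildOffLocus_iff_cells_g22`, …, the latent cells DECIDED by contact, `…_iff_beds`,
`latentWildHugging_empty`,
`wildHugging_iff_g22`, `singularSurface_iff_g22`, `ftt_step_of_g22`); §52 the all-weights CLASSES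
(`NoWildContactFreeOffLocusTowers` = the node's
ONE located residual, superseding aside 28054 `TCNoWildOffLocusTowers`; `NoLatentOffLocusTowers`, …) and the hypothesis-free
`noContactFreeOffLocusTowers_iff_beds` / `noContactFreeNonPrincipalInLocusTowers_iff_beds`.  BY-NAME wiring:
`MaxContactCutLatencyCut`.

[WRITER NOTE (decomp-res writer g7): namespace `…Theorems.HugValuationCut` as the whole lens-4 chain; split by the
critic's order into
`TameCutStage` (§48), `LatencyCutKernels` (§49 + §53), `LatencyCutClasses` (§50) + `LatencyCutCells` (§51 + the
§52 all-weights CLASSES; the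
critic's single `LatencyCutClasses` exceeds the 400-line file limit, hence two files), all four route-independent
(OUTSIDE the Theses cone,
importing only the cone-free `TameCutKernels` instead of the lens's `MaxContactCutTameCut`), and
`MaxContactCutLatencyCut` (inside the cone:
the §52 BY-NAME theorems + the two port-conditional theorems `noTowerPerfect_latent_of_ports` (§50) /
`latentPerfectOffLocus_of_ports` (§51),
whose binder `MaxContactCut.MarkedThreefoldResolution` is a route decl).  `section StageKernel` re-opened in
`LatencyCutKernels`; the global
`set_option linter.dupNamespace false` dropped; the lens's consistency restatement
`contactHugging_of_isAbsContactAt_root'` (≡ the landed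
`TameCutKernels.contactHugging_of_isAbsContactAt_root`, dedup.landed) deleted; nothing else changed.]

(Sources: Giraud1975; EncinasVillamayor2000 Thm. 4.9; BravoGarciaEscamillaVillamayor2012 Lemma 4.6; EGAIV4 Thm.
16.11.2; CossartPiltant2008 Prop. 4.2; BierstoneGrigorievMilmanWlodarczyk2011 Lemma 3.4; GortzWedhorn2020 Prop.
13.96; Liu2002 Thm. 8.1.19; Matsumura1987 Thm. 15.5, Thm. 30.5; CossartJannsenSaito2020; CossartPiltant2019;
Hironaka1964; Moh1987; Cutkosky2009 Thm. 5.1.)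
-/

noncomputable section

open CategoryTheory AlgebraicGeometry IsLocalRing
open Literature.AlgebraicGeometry.Resolution
open Summit.ResolutionOfSingularities.ResolutionOfSingularities.Theorems
open WeakOrderReduction ForcedTowerClasses DivergentTowerClasses MonomialTowerClasses
open HugDimensionClasses HugDimensionKernels SurfaceShadowClasses SurfaceShadowKernels
open ContactShadowClasses (NoTowerImperfect ContactShadow TowerObstructsAll ContactPerfect)
open ContactShadowKernels (noTowerImperfect_of_noTower noTowerImperfect_mono noTower_iff_columns)
open NearPointCut (SingularClass singularSurface_iff_noTower)
open AbsoluteContactClasses (IsAbsContactAt SepResidueAt AbsInv absInv_point hsPortSepResidue sepResidueAt_of_perfectField not_perfectField_of_not_sepResidueAt diffIdeal_restrict_le)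

namespace Summit.ResolutionOfSingularities.ResolutionOfSingularities.Theorems.HugValuationCut

/-! ## §51 (g22 · NEW) THE CELLS CUT ON THE LENS-4 COLUMN at weight `n` — (O), its WILD bed (g21's located residual),
its tame–inseparable bed, (L,¬P), and the leaf 31572 — with their EXACT re-locations -/

/-- **CELL (O, latent)** — off-locus singular-class towers with finite contact latency: ⊆ 31571 BY KERNEL
(`latentOffLocus_of_contact`); perfect column EMPTY-MOD-PORT (`latentPerfectOffLocus_of_ports`). -/
def LatentOffLocusTowersTerminate (n : ℕ) : Prop :=
  NoTower n fun T => (SingularClass T ∧ Nonempty (MarkedShadow T n)) ∧ LatentContact n T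

/-- **CELL (O, contact-free) · THE LOCATED RESIDUAL of (O) after g22**: off-locus singular-class towers that are
PERMANENTLY ABSOLUTELY CONTACT-FREE.  UNDECIDED · IDEA-NEEDED (Frobenius-type initial forms at every infinitely near
point: Moh/kangaroo habitat) · INSTRUMENTABLE (census T-wild-in: 5 of 433 wild chains never show a tame exponent). -/
def ContactFreeOffLocusTowersTerminate (n : ℕ) : Prop :=
  NoTower n fun T => (SingularClass T ∧ Nonempty (MarkedShadow T n)) ∧ ContactFreeTower n T

/-- **CELL (O, wild, latent)** — the DECIDED sub-cell of g21's located residual `WildOffLocusTowersTerminate` (⊆ 31571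
BY KERNEL: `wildLatentOffLocus_of_contact`). -/
def WildLatentOffLocusTowersTerminate (n : ℕ) : Prop :=
  NoTowerWild n fun T => (SingularClass T ∧ Nonempty (MarkedShadow T n)) ∧ LatentContact n T

/-- **CELL (O, wild, contact-free) · THE LOCATED RESIDUAL of g21's (O, wild)**: `p ∣ n` and no absolute contact at any
stage. -/
def WildContactFreeOffLocusTowersTerminate (n : ℕ) : Prop :=
  NoTowerWild n fun T => (SingularClass T ∧ Nonempty (MarkedShadow T n)) ∧ ContactFreeTower n T

/-- **CELL (O, tame–insep, latent)** — the DECIDED sub-cell of g21's located cell (O, tame, inseparable root) (⊆ 31571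
BY KERNEL). -/
def TameInsepLatentOffLocusTowersTerminate (n : ℕ) : Prop :=
  NoTowerTameInsep n fun T => (SingularClass T ∧ Nonempty (MarkedShadow T n)) ∧ LatentContact n T

/-- **CELL (O, tame–insep, contact-free) · LOCATED RESIDUAL of g21's (O, tame, insep)** (imperfect `k`; by
`not_sepResidueAt_stage_of_contactFree` EVERY point of such a tower has inseparable residue field). -/
def TameInsepContactFreeOffLocusTowersTerminate (n : ℕ) : Prop :=
  NoTowerTameInsep n fun T => (SingularClass T ∧ Nonempty (MarkedShadow T n)) ∧ ContactFreeTower n T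

/-- **CELL (L,¬P, latent)** — ⊆ 31571 BY KERNEL. -/
def LatentNonPrincipalInLocusTowersTerminate (n : ℕ) : Prop :=
  NoTower n fun T => (SingularClass T ∧ InLocusShadow T ∧ ∀ S : HugShadow T, ¬ S.Principal) ∧ LatentContact n T

/-- **CELL (L,¬P, contact-free) · LOCATED RESIDUAL of (L,¬P) after g22** (d = 4). -/
def ContactFreeNonPrincipalInLocusTowersTerminate (n : ℕ) : Prop :=
  NoTower n fun T => (SingularClass T ∧ InLocusShadow T ∧ ∀ S : HugShadow T, ¬ S.Principal) ∧ ContactFreeTower n T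

/-- **CELL (L,¬P, wild, contact-free)** — located residual of g21's (L,¬P, wild). -/
def WildContactFreeNonPrincipalInLocusTowersTerminate (n : ℕ) : Prop :=
  NoTowerWild n fun T => (SingularClass T ∧ InLocusShadow T ∧ ∀ S : HugShadow T, ¬ S.Principal) ∧ ContactFreeTower n T

/-- **CELL (L,¬P, tame–insep, contact-free)** — located residual of g21's (L,¬P, tame, insep). -/
def TameInsepContactFreeNonPrincipalInLocusTowersTerminate (n : ℕ) : Prop :=
  NoTowerTameInsep n fun T =>
    (SingularClass T ∧ InLocusShadow T ∧ ∀ S : HugShadow T, ¬ S.Principal) ∧ ContactFreeTower n T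

/-- **CELL (31572, contact-free)** — wild-hugging towers with no absolute contact at any stage: EQUAL to the leaf 31572
at every weight `n ≥ 1` (`wildHugging_iff_g22`, hypothesis-free). -/
def ContactFreeWildHuggingTowersTerminate (n : ℕ) : Prop :=
  NoTower n fun T => (GermHugging T ∧ ¬ ContactHugging T) ∧ ContactFreeTower n T

/-- Kernel (PROVED, pure logic): EXACT `(O) ⟺ (O, latent) ∧ (O, contact-free)`. [folklore] -/
theorem offLocus_iff_cells_g22 {n : ℕ} :
    OffLocusShadowTowersTerminate n ↔ LatentOffLocusTowersTerminate n ∧ ContactFreeOffLocusTowersTerminate n :=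
  noTower_iff_g22 _

/-- Kernel (PROVED, pure logic): EXACT `(L,¬P) ⟺ (L,¬P, latent) ∧ (L,¬P, contact-free)`. [folklore] -/
theorem nonPrincipal_iff_cells_g22 {n : ℕ} :
    NonPrincipalInLocusTowersTerminate n ↔
      LatentNonPrincipalInLocusTowersTerminate n ∧ ContactFreeNonPrincipalInLocusTowersTerminate n :=
  noTower_iff_g22 _

/-- Kernel (PROVED, pure logic): EXACT on g21's located residual `(O, wild) ⟺ (O, wild, latent) ∧ (O, wild,
contact-free)`. [folklore] -/
theorem wildOffLocus_iff_cells_g22 {n : ℕ} :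
    WildOffLocusTowersTerminate n ↔ WildLatentOffLocusTowersTerminate n ∧ WildContactFreeOffLocusTowersTerminate n := by
  rw [WildOffLocusTowersTerminate, noTowerWild_split _ (LatentContact n)]
  exact and_congr Iff.rfl (noTowerWild_congr fun T => by rw [contactFreeTower_iff_not_latent])

/-- Kernel (PROVED, pure logic): EXACT `(O, tame, insep) ⟺ latent ∧ contact-free`. [folklore] -/
theorem tameInsepOffLocus_iff_cells_g22 {n : ℕ} :
    TameInsepOffLocusTowersTerminate n ↔
      TameInsepLatentOffLocusTowersTerminate n ∧ TameInsepContactFreeOffLocusTowersTerminate n := by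
  rw [TameInsepOffLocusTowersTerminate, noTowerTameInsep_split _ (LatentContact n)]
  exact and_congr Iff.rfl (noTowerTameInsep_congr fun T => by rw [contactFreeTower_iff_not_latent])

/-- **KERNEL: (O, latent) terminates as soon as 31571 does at the weight** (no port). [folklore] -/
theorem latentOffLocus_of_contact {n : ℕ} (hn : 1 ≤ n) (h : ContactHuggingTowersTerminate n) :
    LatentOffLocusTowersTerminate n :=
  noTowerLatent_of_contact hn h

/-- **KERNEL: (L,¬P, latent) terminates as soon as 31571 does at the weight** (no port). [folklore] -/
theorem latentNonPrincipal_of_contact {n : ℕ} (hn : 1 ≤ n) (h : ContactHuggingTowersTerminate n) :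
    LatentNonPrincipalInLocusTowersTerminate n :=
  noTowerLatent_of_contact hn h

/-- **KERNEL: (O, wild, latent) — the decided sub-cell of g21's located residual — terminates as soon as 31571
does.** [folklore] -/
theorem wildLatentOffLocus_of_contact {n : ℕ} (hn : 1 ≤ n) (h : ContactHuggingTowersTerminate n) :
    WildLatentOffLocusTowersTerminate n :=
  noTowerWild_of_noTower (noTowerLatent_of_contact hn h)

/-- **KERNEL: (O, tame–insep, latent) terminates as soon as 31571 does.** [folklore] -/
theorem tameInsepLatentOffLocus_of_contact {n : ℕ} (hn : 1 ≤ n) (h : ContactHuggingTowersTerminate n) :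
    TameInsepLatentOffLocusTowersTerminate n :=
  noTowerTameInsep_of_noTower (noTowerLatent_of_contact hn h)

/-- **EXACT RE-LOCATION of (O) GIVEN 31571 at the weight: `(O) ⟺ (O, contact-free)`.** [folklore] -/
theorem offLocus_iff_g22 {n : ℕ} (hn : 1 ≤ n) (h : ContactHuggingTowersTerminate n) :
    OffLocusShadowTowersTerminate n ↔ ContactFreeOffLocusTowersTerminate n :=
  offLocus_iff_cells_g22.trans ⟨fun h' => h'.2, fun h' => ⟨latentOffLocus_of_contact hn h, h'⟩⟩

/-- **EXACT RE-LOCATION of (L,¬P) GIVEN 31571 at the weight.** [folklore] -/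
theorem nonPrincipal_iff_g22 {n : ℕ} (hn : 1 ≤ n) (h : ContactHuggingTowersTerminate n) :
    NonPrincipalInLocusTowersTerminate n ↔ ContactFreeNonPrincipalInLocusTowersTerminate n :=
  nonPrincipal_iff_cells_g22.trans ⟨fun h' => h'.2, fun h' => ⟨latentNonPrincipal_of_contact hn h, h'⟩⟩

/-- **EXACT RE-LOCATION OF g21's LOCATED RESIDUAL GIVEN 31571 at the weight: `(O, wild) ⟺ (O, wild,
contact-free)`.** [folklore] -/
theorem wildOffLocus_iff_g22 {n : ℕ} (hn : 1 ≤ n) (h : ContactHuggingTowersTerminate n) :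
    WildOffLocusTowersTerminate n ↔ WildContactFreeOffLocusTowersTerminate n :=
  wildOffLocus_iff_cells_g22.trans ⟨fun h' => h'.2, fun h' => ⟨wildLatentOffLocus_of_contact hn h, h'⟩⟩

/-- **EXACT RE-LOCATION of g21's (O, tame, insep) GIVEN 31571 at the weight.** [folklore] -/
theorem tameInsepOffLocus_iff_g22 {n : ℕ} (hn : 1 ≤ n) (h : ContactHuggingTowersTerminate n) :
    TameInsepOffLocusTowersTerminate n ↔ TameInsepContactFreeOffLocusTowersTerminate n :=
  tameInsepOffLocus_iff_cells_g22.trans ⟨fun h' => h'.2, fun h' => ⟨tameInsepLatentOffLocus_of_contact hn h, h'⟩⟩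

/-- **EXACT, hypothesis-free: the residual of (O) on g21's axis — `(O, contact-free) ⟺ (O, wild, cf) ∧ (O,
tame–insep, cf)`**
(its tame–separable bed is EMPTY). [folklore] -/
theorem contactFreeOffLocus_iff_beds {n : ℕ} :
    ContactFreeOffLocusTowersTerminate n ↔
      WildContactFreeOffLocusTowersTerminate n ∧ TameInsepContactFreeOffLocusTowersTerminate n :=
  noTowerContactFree_iff_beds _

/-- **EXACT, hypothesis-free: `(L,¬P, contact-free) ⟺ wild ∧ tame–insep`.** [folklore] -/
theorem contactFreeNonPrincipal_iff_beds {n : ℕ} :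
    ContactFreeNonPrincipalInLocusTowersTerminate n ↔
      WildContactFreeNonPrincipalInLocusTowersTerminate n ∧ TameInsepContactFreeNonPrincipalInLocusTowersTerminate n :=
  noTowerContactFree_iff_beds _

/-- the located residual is WEAKER (by letter) than g21's located residual. [folklore] -/
theorem wildContactFreeOffLocus_of_wildOffLocus {n : ℕ} (h : WildOffLocusTowersTerminate n) :
    WildContactFreeOffLocusTowersTerminate n :=
  noTowerWild_mono (fun _ h' => h'.1) h

/-- the located residual of (O) is WEAKER than g21's pair of located cells. [folklore] -/
theorem contactFreeOffLocus_of_g21 {n : ℕ} (hW : WildOffLocusTowersTerminate n)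
    (hI : TameInsepOffLocusTowersTerminate n) : ContactFreeOffLocusTowersTerminate n :=
  noTowerContactFree_of_g21 hW hI

/-- the located residual of (L,¬P) is WEAKER than g21's pair of located cells. [folklore] -/
theorem contactFreeNonPrincipal_of_g21 {n : ℕ} (hW : WildNonPrincipalInLocusTowersTerminate n)
    (hI : TameInsepNonPrincipalInLocusTowersTerminate n) : ContactFreeNonPrincipalInLocusTowersTerminate n :=
  noTowerContactFree_of_g21 hW hI

/-- (O, contact-free) is WEAKER than (O) by letter. [folklore] -/
theorem contactFreeOffLocus_of_offLocus {n : ℕ} (h : OffLocusShadowTowersTerminate n) :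
    ContactFreeOffLocusTowersTerminate n :=
  noTowerContactFree_of_noTower h

/-- (L,¬P, contact-free) is WEAKER than (L,¬P) by letter. [folklore] -/
theorem contactFreeNonPrincipal_of_nonPrincipal {n : ℕ} (h : NonPrincipalInLocusTowersTerminate n) :
    ContactFreeNonPrincipalInLocusTowersTerminate n :=
  noTowerContactFree_of_noTower h

/-- **KERNEL (PROVED, hypothesis-free): the LATENT half of the leaf 31572 is EMPTY** — a wild-hugging tower hugs no
regular hypersurface germ, but finite latency produces one. [folklore] -/
theorem latentWildHugging_empty {n : ℕ} (hn : 1 ≤ n) :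
    NoTower n fun T => (GermHugging T ∧ ¬ ContactHugging T) ∧ LatentContact n T :=
  noTowerLatent_of_not_contact hn fun _ h => h.2

/-- **EXACT, hypothesis-free: 31572 at weight `n ≥ 1` IS its contact-free column** — «a minimal wild-hugging tower is
permanently absolutely contact-free». [folklore] -/
theorem wildHugging_iff_g22 {n : ℕ} (hn : 1 ≤ n) :
    WildHuggingTowersTerminate n ↔ ContactFreeWildHuggingTowersTerminate n :=
  (noTower_iff_g22 _).trans ⟨fun h => h.2, fun h => ⟨latentWildHugging_empty hn, h⟩⟩

/-- **EXACT AT THE HOST'S WEIGHT-`n` CONJUNCT given the g19 ports, the lower weights and 31571 at the weight: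
`SingularSurface(n) ⟺ (O, cf) ∧ (L,¬P, cf) ∧ (L,P,pure) ∧ (imperfect residual)`.** [folklore] -/
theorem singularSurface_iff_g22 {n : ℕ} (hn : 1 ≤ n) (hP : ShadowPort n) (hM : MarkingPort n) (hDesc : DescentPort n)
    (hFC : FactorContactPort n) (hCo : CouplingPort n) (hRi : RiderPort n)
    (hlow : ∀ n' : ℕ, 1 ≤ n' → n' < n → ForcedTowersTerminate n') (h71 : ContactHuggingTowersTerminate n) :
    SingularSurfaceHuggingTowersTerminate n ↔ ContactFreeOffLocusTowersTerminate n ∧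
      ContactFreeNonPrincipalInLocusTowersTerminate n ∧ PurePrincipalTowersTerminate n ∧
        IncommensurableWildDriftingImperfectTowersTerminate n := by
  rw [singularSurface_iff_g19 hP hM hDesc hFC hCo hRi hlow, offLocus_iff_g22 hn h71, nonPrincipal_iff_g22 hn h71]

/-- **KERNEL — the ROOT PIECE at weight `n`** from the g22 cells, 31571 at the weight, the ports and the lower
weights. [folklore] -/
theorem ftt_step_of_g22 {n : ℕ} (hn : 1 ≤ n) (hMo : MonomialCorner n) (hC : CurveLaw n) (hSL : SurfaceLaw n)
    (hH : HypersurfaceHuggingTowersTerminate n) (hP : ShadowPort n) (hM : MarkingPort n) (hDesc : DescentPort n)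
    (hFC : FactorContactPort n) (hCo : CouplingPort n) (hRi : RiderPort n) (h71 : ContactHuggingTowersTerminate n)
    (hO : ContactFreeOffLocusTowersTerminate n) (hNP : ContactFreeNonPrincipalInLocusTowersTerminate n)
    (hPu : PurePrincipalTowersTerminate n) (hR : IncommensurableWildDriftingImperfectTowersTerminate n)
    (hlow : ∀ n' : ℕ, 1 ≤ n' → n' < n → ForcedTowersTerminate n') : ForcedTowersTerminate n :=
  ftt_step_of_g19 hn hMo hC hSL hH hP hM hDesc hFC hCo hRi ((offLocus_iff_g22 hn h71).mpr hO)
    ((nonPrincipal_iff_g22 hn h71).mpr hNP) hPu hR hlow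

/-! ## §52 (g22 · NEW) Up to the booked MaxContactCut items BY NAME — all weights -/

/-- (O, latent) over all weights. -/
def NoLatentOffLocusTowers : Prop := ∀ n : ℕ, 1 ≤ n → LatentOffLocusTowersTerminate n

/-- **THE LOCATED RESIDUAL (O, contact-free) over all weights.** -/
def NoContactFreeOffLocusTowers : Prop := ∀ n : ℕ, 1 ≤ n → ContactFreeOffLocusTowersTerminate n

/-- **THE LOCATED RESIDUAL of g21's aside-candidate `NoWildOffLocusTowers`: (O, wild, contact-free) over all weights.** -/
def NoWildContactFreeOffLocusTowers : Prop := ∀ n : ℕ, 1 ≤ n → WildContactFreeOffLocusTowersTerminate n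

/-- (O, tame–insep, contact-free) over all weights (imperfect `k` only). -/
def NoTameInsepContactFreeOffLocusTowers : Prop := ∀ n : ℕ, 1 ≤ n → TameInsepContactFreeOffLocusTowersTerminate n

/-- (L,¬P, latent) over all weights. -/
def NoLatentNonPrincipalInLocusTowers : Prop := ∀ n : ℕ, 1 ≤ n → LatentNonPrincipalInLocusTowersTerminate n

/-- (L,¬P, contact-free) over all weights. -/
def NoContactFreeNonPrincipalInLocusTowers : Prop := ∀ n : ℕ, 1 ≤ n → ContactFreeNonPrincipalInLocusTowersTerminate n

/-- (L,¬P, wild, contact-free) over all weights. -/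
def NoWildContactFreeNonPrincipalInLocusTowers : Prop :=
  ∀ n : ℕ, 1 ≤ n → WildContactFreeNonPrincipalInLocusTowersTerminate n

/-- (L,¬P, tame–insep, contact-free) over all weights. -/
def NoTameInsepContactFreeNonPrincipalInLocusTowers : Prop :=
  ∀ n : ℕ, 1 ≤ n → TameInsepContactFreeNonPrincipalInLocusTowersTerminate n

/-- (31572, contact-free) over all weights. -/
def NoContactFreeWildHuggingTowers : Prop := ∀ n : ℕ, 1 ≤ n → ContactFreeWildHuggingTowersTerminate n

/-- **EXACT, hypothesis-free, over all weights: `(O, cf) ⟺ (O, wild, cf) ∧ (O, tame–insep, cf)`.** [folklore] -/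
theorem noContactFreeOffLocusTowers_iff_beds :
    NoContactFreeOffLocusTowers ↔ NoWildContactFreeOffLocusTowers ∧ NoTameInsepContactFreeOffLocusTowers :=
  ⟨fun h => ⟨fun n hn => (contactFreeOffLocus_iff_beds.mp (h n hn)).1,
      fun n hn => (contactFreeOffLocus_iff_beds.mp (h n hn)).2⟩,
    fun h n hn => contactFreeOffLocus_iff_beds.mpr ⟨h.1 n hn, h.2 n hn⟩⟩

/-- **EXACT, hypothesis-free, over all weights: `(L,¬P, cf) ⟺ wild ∧ tame–insep`.** [folklore] -/
theorem noContactFreeNonPrincipalInLocusTowers_iff_beds :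
    NoContactFreeNonPrincipalInLocusTowers ↔
      NoWildContactFreeNonPrincipalInLocusTowers ∧ NoTameInsepContactFreeNonPrincipalInLocusTowers :=
  ⟨fun h => ⟨fun n hn => (contactFreeNonPrincipal_iff_beds.mp (h n hn)).1,
      fun n hn => (contactFreeNonPrincipal_iff_beds.mp (h n hn)).2⟩,
    fun h n hn => contactFreeNonPrincipal_iff_beds.mpr ⟨h.1 n hn, h.2 n hn⟩⟩

end Summit.ResolutionOfSingularities.ResolutionOfSingularities.Theorems.HugValuationCut
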